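import Summits.HubbardSuperconductivity.HubbardSuperconductivity.Theorems.BalabanIRBirComplexStableXYContourShift
import Summits.HubbardSuperconductivity.HubbardSuperconductivity.Theorems.BalabanIRBirComplexStableXYGaugeTwist

/-!
# The global gauge identity for the BKW witness of `BalabanIR.BirComplexStableXY` (stmt-HubbardSuperconductivity-2080)

Line `theta-rotor-equimodular-zeros` (line lead prover-line-stmt-HubbardSuperconductivity-2080-0, 2026-08-16), registered stub
`stub_partZ_witness_gauge`, obtained by composing the two landed stubs `stub_cube_contour_shift` (iterated complex contour shift
on the torus `[0,2π]^Λ`, Theorems/BalabanIRBirComplexStableXYContourShift) and `stub_partZ_witness_gauge_of_shift`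
(Theorems/BalabanIRBirComplexStableXYGaugeTwist): for every `K`, `L`, `M ≥ 1` and any complex `R, ψ` with `R cos ψ = 1 + iε₁`,
`R sin ψ = iε₂`, the witness partition function `Z = partZ K (witness ε₁ ε₂) L M` EQUALS the partition function of the
nearest-neighbour XY model on `(ℤ/L)² × ℤ/M` with real spatial stiffness `4K`, complex temporal stiffness `4KR`, and a complex
TWIST `Mψ` on the wrap-around temporal bonds `τ = M−1 → 0`.  Consequently the Berry-like parameter `ε₂` enters `Z` only through
the boundary twist (charge-sector weights `e^{iQMψ}`) and through `R` — the exact reduction behind the Beraha–Kahane–Weiss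
zeros of `Z` (two charge sectors tie in modulus and acquire a tunable relative phase).
-/

namespace Summit.HubbardSuperconductivity.BirComplexStableXYNegative

open scoped BigOperators
open MeasureTheory Literature.Probability.LatticeModels

noncomputable section

/-- THE GLOBAL GAUGE IDENTITY (registered stub `stub_partZ_witness_gauge`, exact, every `L`, every `M ≥ 1`):
`Z = ∫_cube exp(−4K Σ_s [(1−cos ∂₁θ s) + (1−cos ∂₂θ s) + (1+iε₁) − R cos(∂_τθ s + twist s)])`, `twist = Mψ` on the last time
slice and `0` elsewhere, whenever `R cos ψ = 1 + iε₁` and `R sin ψ = iε₂`. -/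
theorem stub_partZ_witness_gauge :
    ∀ (K ε₁ ε₂ : ℝ) (L M : ℕ) [NeZero L] [NeZero M] (R ψ : ℂ),
      R * Complex.cos ψ = 1 + Complex.I * ε₁ → R * Complex.sin ψ = Complex.I * ε₂ →
        partZ K (witness ε₁ ε₂) L M =
          MeasureTheory.integral (MeasureTheory.volume.restrict (cube L M)) (fun θ =>
            Complex.exp (-(4 * (K : ℂ)) * ∑ s : Λ L M,
              ( (((1 - Real.cos (θ (s.1 + ![1, 0], s.2) - θ s) : ℝ)) : ℂ)
              + (((1 - Real.cos (θ (s.1 + ![0, 1], s.2) - θ s) : ℝ)) : ℂ)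
              + ((1 : ℂ) + Complex.I * ε₁)
              - R * Complex.cos (((θ (s.1, s.2 + 1) - θ s : ℝ) : ℂ)
                  + (if (s.2).val = M - 1 then (M : ℂ) * ψ else 0)) ))) :=
  fun K ε₁ ε₂ L M _ _ R ψ hR hψ =>
    stub_partZ_witness_gauge_of_shift K ε₁ ε₂ L M R ψ (stub_cube_contour_shift L M) hR hψ

/-- The global gauge identity under its descriptive name (same statement as `stub_partZ_witness_gauge`). -/
theorem partZ_witness_gauge (K ε₁ ε₂ : ℝ) (L M : ℕ) [NeZero L] [NeZero M] (R ψ : ℂ)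
    (hR : R * Complex.cos ψ = 1 + Complex.I * ε₁) (hψ : R * Complex.sin ψ = Complex.I * ε₂) :
    partZ K (witness ε₁ ε₂) L M =
      MeasureTheory.integral (MeasureTheory.volume.restrict (cube L M)) (fun θ =>
        Complex.exp (-(4 * (K : ℂ)) * ∑ s : Λ L M,
          ( (((1 - Real.cos (θ (s.1 + ![1, 0], s.2) - θ s) : ℝ)) : ℂ)
          + (((1 - Real.cos (θ (s.1 + ![0, 1], s.2) - θ s) : ℝ)) : ℂ)
          + ((1 : ℂ) + Complex.I * ε₁)
          - R * Complex.cos (((θ (s.1, s.2 + 1) - θ s : ℝ) : ℂ)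
              + (if (s.2).val = M - 1 then (M : ℂ) * ψ else 0)) ))) :=
  stub_partZ_witness_gauge K ε₁ ε₂ L M R ψ hR hψ

end

end Summit.HubbardSuperconductivity.BirComplexStableXYNegative
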